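import Literature.NumberTheory.Sieve.TwistedWeightMellin
import HarnessLib

/-!
# The second symmetric difference of `Ŵ_λ(s)` in `Im s`

Topic `Literature/NumberTheory/Sieve`; a PROVED tool file complementing `TwistedWeightMellin`
([Harper2016, §5], smoothed major arcs). For the Mellin transform
`Ŵ_λ(s) = ∫₀¹ v^{s+1}(1−v)² e(λv) dv` of the twisted weight `v²(1−v)²e(λv)` the tree has the
FIRST-order variation `‖Ŵ_λ(σ+iτ) − Ŵ_λ(σ)‖ ≤ 2|τ|/(1+|λ|)` (`norm_twistMellin_sub_le`). The
saddle-point method at the precision `1 + O(1/u)` (Hildebrand–Tenenbaum's Lemma 11 at second order,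
`SaddleWindowSecondOrder`) needs one more order, and the cheapest form avoiding `log v`-weighted Mellin
transforms is the SECOND SYMMETRIC DIFFERENCE:

* `norm_exp_mul_I_add_exp_neg_sub_two_le`: `‖e^{iθ} + e^{−iθ} − 2‖ ≤ θ²`;
* `norm_cpow_symmDiff_le`: `‖v^{z+iτ} + v^{z−iτ} − 2v^z‖ ≤ v^{Re z} (τ log v)²` (`v > 0`);
* `norm_twistMellin_symmDiff_le_sq`: `‖Ŵ_λ(σ+iτ) + Ŵ_λ(σ−iτ) − 2Ŵ_λ(σ)‖ ≤ 4τ²` (`σ ≥ 0`);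
* `norm_twistMellin_symmDiff_le_div`: `≤ 44τ²/(2π|λ|)` for `1/2 ≤ σ ≤ 1`, `λ ≠ 0` (via the
  integrated-by-parts representation `twistMellin_eq_parts`, no new integration by parts);
* `norm_twistMellin_symmDiff_le`: `≤ 15τ²/(1+|λ|)` for `1/2 ≤ σ ≤ 1`.

## References

* A. J. Harper, Compositio Math. 152 (2016) 1121–1158, §5 [Harper2016].
* A. Hildebrand, G. Tenenbaum, Trans. AMS 296 (1986), §4 (Lemma 11) [HildebrandTenenbaum1986].
-/

noncomputable section

open Real Complex MeasureTheory Set intervalIntegral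
open scoped FourierTransform

namespace Literature.NumberTheory.Sieve

namespace TwistedWeight

/-! ### Pointwise second differences -/

/-- `‖e^{iθ} + e^{−iθ} − 2‖ = 2(1 − cos θ) ≤ θ²`. [folklore] -/
theorem norm_exp_mul_I_add_exp_neg_sub_two_le (θ : ℝ) :
    ‖Complex.exp ((θ : ℂ) * I) + Complex.exp (-((θ : ℂ) * I)) - 2‖ ≤ θ ^ 2 := by
  have h : Complex.exp ((θ : ℂ) * I) + Complex.exp (-((θ : ℂ) * I)) - 2 =
      ((2 * Real.cos θ - 2 : ℝ) : ℂ) := by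
    rw [← neg_mul, ← Complex.two_cos, ← Complex.ofReal_cos]
    push_cast
    ring
  rw [h, Complex.norm_real, Real.norm_eq_abs]
  have h1 := Real.one_sub_sq_div_two_le_cos (x := θ)
  have h2 := Real.cos_le_one θ
  rw [abs_of_nonpos (by linarith)]
  linarith

/-- `‖v^{z+iτ} + v^{z−iτ} − 2v^z‖ ≤ v^{Re z} (τ log v)²` for `v > 0`. [folklore] -/
theorem norm_cpow_symmDiff_le {v : ℝ} (hv : 0 < v) (z : ℂ) (τ : ℝ) :
    ‖(v : ℂ) ^ (z + τ * I) + (v : ℂ) ^ (z - τ * I) - 2 * (v : ℂ) ^ z‖ ≤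
      v ^ z.re * (τ * Real.log v) ^ 2 := by
  have hv0 : (v : ℂ) ≠ 0 := by exact_mod_cast hv.ne'
  have e1 : (v : ℂ) ^ ((τ : ℂ) * I) = Complex.exp (((τ * Real.log v : ℝ) : ℂ) * I) := by
    rw [Complex.cpow_def_of_ne_zero hv0, ← Complex.ofReal_log hv.le]
    congr 1; push_cast; ring
  have e2 : (v : ℂ) ^ (-((τ : ℂ) * I)) = Complex.exp (-(((τ * Real.log v : ℝ) : ℂ) * I)) := by
    rw [Complex.cpow_def_of_ne_zero hv0, ← Complex.ofReal_log hv.le]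
    congr 1; push_cast; ring
  rw [sub_eq_add_neg z, Complex.cpow_add _ _ hv0, Complex.cpow_add _ _ hv0, e1, e2]
  have hfac : (v : ℂ) ^ z * Complex.exp (((τ * Real.log v : ℝ) : ℂ) * I) +
      (v : ℂ) ^ z * Complex.exp (-(((τ * Real.log v : ℝ) : ℂ) * I)) - 2 * (v : ℂ) ^ z =
      (v : ℂ) ^ z * (Complex.exp (((τ * Real.log v : ℝ) : ℂ) * I) +
        Complex.exp (-(((τ * Real.log v : ℝ) : ℂ) * I)) - 2) := by ring
  rw [hfac, norm_mul, Complex.norm_cpow_eq_rpow_re_of_pos hv]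
  exact mul_le_mul_of_nonneg_left (norm_exp_mul_I_add_exp_neg_sub_two_le _) (by positivity)

/-- `‖v^{z+iτ} − v^{z−iτ}‖ ≤ 2 v^{Re z} |τ| |log v|` for `v > 0`. [folklore] -/
theorem norm_cpow_antiDiff_le {v : ℝ} (hv : 0 < v) (z : ℂ) (τ : ℝ) :
    ‖(v : ℂ) ^ (z + τ * I) - (v : ℂ) ^ (z - τ * I)‖ ≤ v ^ z.re * (2 * |τ| * |Real.log v|) := by
  have h1 := norm_cpow_add_mul_I_sub_le hv z τ
  have h2 := norm_cpow_add_mul_I_sub_le hv z (-τ)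
  have e : z - τ * I = z + ((-τ : ℝ) : ℂ) * I := by push_cast; ring
  rw [e]
  rw [abs_neg] at h2
  calc ‖(v : ℂ) ^ (z + τ * I) - (v : ℂ) ^ (z + ((-τ : ℝ) : ℂ) * I)‖
      = ‖((v : ℂ) ^ (z + τ * I) - (v : ℂ) ^ z) - ((v : ℂ) ^ (z + ((-τ : ℝ) : ℂ) * I) - (v : ℂ) ^ z)‖ := by
        ring_nf
    _ ≤ ‖(v : ℂ) ^ (z + τ * I) - (v : ℂ) ^ z‖ + ‖(v : ℂ) ^ (z + ((-τ : ℝ) : ℂ) * I) - (v : ℂ) ^ z‖ :=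
        norm_sub_le _ _
    _ ≤ v ^ z.re * (|τ| * |Real.log v|) + v ^ z.re * (|τ| * |Real.log v|) := add_le_add h1 h2
    _ = v ^ z.re * (2 * |τ| * |Real.log v|) := by ring

/-- `v log² v < 4` on `(0, 1]` (`√v |log v| < 2`). [folklore] -/
theorem mul_log_sq_lt_four {v : ℝ} (hv : 0 < v) (hv1 : v ≤ 1) : v * Real.log v ^ 2 < 4 := by
  have h := rpow_mul_abs_log_lt hv hv1 (by norm_num : (0 : ℝ) < 1 / 2)
  have h0 : 0 ≤ v ^ (1 / 2 : ℝ) * |Real.log v| := by positivity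
  have hsq : (v ^ (1 / 2 : ℝ) * |Real.log v|) ^ 2 = v * Real.log v ^ 2 := by
    rw [mul_pow, sq_abs, ← Real.rpow_natCast, ← Real.rpow_mul hv.le]; norm_num
  rw [← hsq]
  nlinarith

/-- `v^σ log² v < 16` on `(0, 1]` for `σ ≥ 1/2` (`v^{σ/2} |log v| < 2/σ ≤ 4`). [folklore] -/
theorem rpow_mul_log_sq_lt {v σ : ℝ} (hv : 0 < v) (hv1 : v ≤ 1) (hσ : 1 / 2 ≤ σ) :
    v ^ σ * Real.log v ^ 2 < 16 := by
  have hσ0 : 0 < σ / 2 := by linarith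
  have h := rpow_mul_abs_log_lt hv hv1 hσ0
  have h4 : 1 / (σ / 2) ≤ 4 := by rw [div_le_iff₀ hσ0]; linarith
  have h0 : 0 ≤ v ^ (σ / 2) * |Real.log v| := by positivity
  have hlt : v ^ (σ / 2) * |Real.log v| < 4 := lt_of_lt_of_le h h4
  have hsq : (v ^ (σ / 2) * |Real.log v|) ^ 2 = v ^ σ * Real.log v ^ 2 := by
    rw [mul_pow, sq_abs, ← Real.rpow_natCast, ← Real.rpow_mul hv.le]; norm_num
  rw [← hsq]
  nlinarith

/-! ### The second symmetric difference of `Ŵ_λ`: direct bound -/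

/-- **Direct bound**: `‖Ŵ_λ(σ+iτ) + Ŵ_λ(σ−iτ) − 2Ŵ_λ(σ)‖ ≤ 4τ²` for `σ ≥ 0`
(pointwise `v^{σ+1}(τ log v)² ≤ τ² · v log² v ≤ 4τ²`). [folklore] -/
theorem norm_twistMellin_symmDiff_le_sq {σ : ℝ} (hσ : 0 ≤ σ) (τ lam : ℝ) :
    ‖twistMellin lam (σ + τ * I) + twistMellin lam (σ - τ * I) - 2 * twistMellin lam σ‖ ≤ 4 * τ ^ 2 := by
  unfold twistMellin
  have hz1 : 0 < ((σ : ℂ) + τ * I + 1).re := by simp; linarith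
  have hz2 : 0 < ((σ : ℂ) - τ * I + 1).re := by simp; linarith
  have hz3 : 0 < ((σ : ℂ) + 1).re := by simp; linarith
  have i1 := intervalIntegrable_integrand hz1 lam
  have i2 := intervalIntegrable_integrand hz2 lam
  have i3 := (intervalIntegrable_integrand hz3 lam).const_mul (2 : ℂ)
  rw [← intervalIntegral.integral_const_mul, ← intervalIntegral.integral_add i1 i2,
    ← intervalIntegral.integral_sub (i1.add i2) i3]
  calc ‖∫ v in (0 : ℝ)..1, ((v : ℂ) ^ ((σ : ℂ) + τ * I + 1) * ((((1 - v) ^ 2 : ℝ)) : ℂ) * (𝐞 (lam * v) : ℂ) +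
        (v : ℂ) ^ ((σ : ℂ) - τ * I + 1) * ((((1 - v) ^ 2 : ℝ)) : ℂ) * (𝐞 (lam * v) : ℂ)) -
        2 * ((v : ℂ) ^ ((σ : ℂ) + 1) * ((((1 - v) ^ 2 : ℝ)) : ℂ) * (𝐞 (lam * v) : ℂ))‖
      ≤ 4 * τ ^ 2 * |(1 : ℝ) - 0| := by
        refine intervalIntegral.norm_integral_le_of_norm_le_const fun v hv => ?_
        rw [uIoc_of_le zero_le_one, mem_Ioc] at hv
        obtain ⟨hv0, hv1⟩ := hv
        have ea : (σ : ℂ) + τ * I + 1 = ((σ : ℂ) + 1) + τ * I := by ring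
        have eb : (σ : ℂ) - τ * I + 1 = ((σ : ℂ) + 1) - τ * I := by ring
        have hfac : (v : ℂ) ^ ((σ : ℂ) + τ * I + 1) * ((((1 - v) ^ 2 : ℝ)) : ℂ) * (𝐞 (lam * v) : ℂ) +
            (v : ℂ) ^ ((σ : ℂ) - τ * I + 1) * ((((1 - v) ^ 2 : ℝ)) : ℂ) * (𝐞 (lam * v) : ℂ) -
            2 * ((v : ℂ) ^ ((σ : ℂ) + 1) * ((((1 - v) ^ 2 : ℝ)) : ℂ) * (𝐞 (lam * v) : ℂ)) =
            ((v : ℂ) ^ (((σ : ℂ) + 1) + τ * I) + (v : ℂ) ^ (((σ : ℂ) + 1) - τ * I) - 2 * (v : ℂ) ^ ((σ : ℂ) + 1)) *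
              ((((1 - v) ^ 2 : ℝ)) : ℂ) * (𝐞 (lam * v) : ℂ) := by
          rw [ea, eb]; ring
        rw [hfac, norm_mul, norm_mul, Circle.norm_coe, mul_one, Complex.norm_real, Real.norm_eq_abs,
          abs_of_nonneg (by positivity)]
        have h1 := norm_cpow_symmDiff_le hv0 ((σ : ℂ) + 1) τ
        have hre : ((σ : ℂ) + 1).re = σ + 1 := by simp
        rw [hre] at h1
        have h2 : v ^ (σ + 1) ≤ v := by
          calc v ^ (σ + 1) ≤ v ^ (1 : ℝ) := Real.rpow_le_rpow_of_exponent_ge hv0 hv1 (by linarith)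
            _ = v := Real.rpow_one v
        have h3 := mul_log_sq_lt_four hv0 hv1
        have h4 : (1 - v) ^ 2 ≤ 1 := by nlinarith
        have h5 : v ^ (σ + 1) * (τ * Real.log v) ^ 2 ≤ 4 * τ ^ 2 := by
          calc v ^ (σ + 1) * (τ * Real.log v) ^ 2 ≤ v * (τ * Real.log v) ^ 2 :=
                mul_le_mul_of_nonneg_right h2 (sq_nonneg _)
            _ = τ ^ 2 * (v * Real.log v ^ 2) := by ring
            _ ≤ τ ^ 2 * 4 := mul_le_mul_of_nonneg_left h3.le (sq_nonneg _)
            _ = 4 * τ ^ 2 := by ring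
        calc ‖(v : ℂ) ^ (((σ : ℂ) + 1) + τ * I) + (v : ℂ) ^ (((σ : ℂ) + 1) - τ * I) - 2 * (v : ℂ) ^ ((σ : ℂ) + 1)‖ *
              (1 - v) ^ 2 ≤ (4 * τ ^ 2) * 1 :=
              mul_le_mul (h1.trans h5) h4 (by positivity) (by positivity)
          _ = 4 * τ ^ 2 := by ring
    _ = 4 * τ ^ 2 := by norm_num

/-! ### The second symmetric difference of `Ŵ_λ`: the `1/λ` bound -/

/-- The integrand `((s+1)v^s(1−v)² − 2v^{s+1}(1−v)) e(λv)` of `twistMellin_eq_parts` is interval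
integrable on `[0,1]` (`Re s > 0`). [folklore] -/
theorem intervalIntegrable_parts_integrand {s : ℂ} (hs : 0 < s.re) (lam : ℝ) :
    IntervalIntegrable (fun v : ℝ => ((s + 1) * (v : ℂ) ^ s * ((((1 - v) ^ 2 : ℝ)) : ℂ) +
      (v : ℂ) ^ (s + 1) * (((-(2 * (1 - v)) : ℝ)) : ℂ)) * (𝐞 (lam * v) : ℂ)) volume 0 1 := by
  have hs1 : 0 < (s + 1).re := by simp; linarith
  refine (Continuous.mul ?_ ?_).intervalIntegrable 0 1
  · exact ((continuous_const.mul (continuous_ofReal_cpow hs)).mul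
      (Complex.continuous_ofReal.comp (by fun_prop))).add
      ((continuous_ofReal_cpow hs1).mul (Complex.continuous_ofReal.comp (by fun_prop)))
  · exact continuous_iff_continuousAt.mpr fun v =>
      (hasDerivAt_fourierChar_mul lam v).differentiableAt.continuousAt

/-- The pointwise bound behind `norm_twistMellin_symmDiff_le_div`: for `v ∈ (0,1]`, `1/2 ≤ σ ≤ 1`,
with `P_s(v) = (s+1)v^s(1−v)² − 2v^{s+1}(1−v)`,
`‖P_{σ+iτ}(v) + P_{σ−iτ}(v) − 2P_σ(v)‖ ≤ 44 τ²`. [folklore] -/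
theorem norm_parts_symmDiff_le {σ v : ℝ} (hσ : 1 / 2 ≤ σ) (hσ1 : σ ≤ 1) (hv0 : 0 < v) (hv1 : v ≤ 1)
    (τ : ℝ) :
    ‖((((σ : ℂ) + τ * I) + 1) * (v : ℂ) ^ ((σ : ℂ) + τ * I) * ((((1 - v) ^ 2 : ℝ)) : ℂ) +
        (v : ℂ) ^ (((σ : ℂ) + τ * I) + 1) * (((-(2 * (1 - v)) : ℝ)) : ℂ)) +
      ((((σ : ℂ) - τ * I) + 1) * (v : ℂ) ^ ((σ : ℂ) - τ * I) * ((((1 - v) ^ 2 : ℝ)) : ℂ) +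
        (v : ℂ) ^ (((σ : ℂ) - τ * I) + 1) * (((-(2 * (1 - v)) : ℝ)) : ℂ)) -
      2 * ((((σ : ℂ)) + 1) * (v : ℂ) ^ (σ : ℂ) * ((((1 - v) ^ 2 : ℝ)) : ℂ) +
        (v : ℂ) ^ ((σ : ℂ) + 1) * (((-(2 * (1 - v)) : ℝ)) : ℂ))‖ ≤ 44 * τ ^ 2 := by
  have hσ0 : 0 < σ := by linarith
  -- regroup
  have ea : (σ : ℂ) + τ * I + 1 = ((σ : ℂ) + 1) + τ * I := by ring
  have eb : (σ : ℂ) - τ * I + 1 = ((σ : ℂ) + 1) - τ * I := by ring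
  set q : ℂ := ((((1 - v) ^ 2 : ℝ)) : ℂ) with hq
  set m : ℂ := (((-(2 * (1 - v)) : ℝ)) : ℂ) with hm
  set a : ℂ := (v : ℂ) ^ ((σ : ℂ) + τ * I) with ha
  set b : ℂ := (v : ℂ) ^ ((σ : ℂ) - τ * I) with hb
  set c : ℂ := (v : ℂ) ^ (σ : ℂ) with hc
  set a' : ℂ := (v : ℂ) ^ (((σ : ℂ) + 1) + τ * I) with ha'
  set b' : ℂ := (v : ℂ) ^ (((σ : ℂ) + 1) - τ * I) with hb'
  set c' : ℂ := (v : ℂ) ^ ((σ : ℂ) + 1) with hc'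
  rw [ea, eb]
  have hdec : (((σ : ℂ) + 1) + τ * I) * a * q + a' * m + ((((σ : ℂ) + 1) - τ * I) * b * q + b' * m) -
      2 * (((σ : ℂ) + 1) * c * q + c' * m) =
      (((σ : ℂ) + 1) * (a + b - 2 * c) + τ * I * (a - b)) * q + (a' + b' - 2 * c') * m := by ring
  rw [hdec]
  -- norms of the pieces
  have hqn : ‖q‖ ≤ 1 := by
    rw [hq, Complex.norm_real, Real.norm_eq_abs, abs_of_nonneg (by positivity)]; nlinarith
  have hmn : ‖m‖ ≤ 2 := by
    rw [hm, Complex.norm_real, Real.norm_eq_abs, abs_neg, abs_of_nonneg (by linarith)]; linarith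
  have hσn : ‖((σ : ℂ) + 1)‖ = σ + 1 := by
    rw [show (σ : ℂ) + 1 = ((σ + 1 : ℝ) : ℂ) by push_cast; ring, Complex.norm_real, Real.norm_eq_abs,
      abs_of_pos (by linarith)]
  have h1 : ‖a + b - 2 * c‖ ≤ v ^ σ * (τ * Real.log v) ^ 2 := by
    have := norm_cpow_symmDiff_le hv0 (σ : ℂ) τ
    rwa [Complex.ofReal_re] at this
  have h2 : ‖a - b‖ ≤ v ^ σ * (2 * |τ| * |Real.log v|) := by
    have := norm_cpow_antiDiff_le hv0 (σ : ℂ) τ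
    rwa [Complex.ofReal_re] at this
  have h3 : ‖a' + b' - 2 * c'‖ ≤ v ^ (σ + 1) * (τ * Real.log v) ^ 2 := by
    have := norm_cpow_symmDiff_le hv0 ((σ : ℂ) + 1) τ
    have hre : ((σ : ℂ) + 1).re = σ + 1 := by simp
    rwa [hre] at this
  -- the elementary bounds `v^σ log² v < 16`, `v^σ |log v| < 2`, `v^{σ+1} log² v < 4`
  have k1 := rpow_mul_log_sq_lt hv0 hv1 hσ
  have k2 : v ^ σ * |Real.log v| < 2 := by
    have h := rpow_mul_abs_log_lt hv0 hv1 hσ0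
    have : 1 / σ ≤ 2 := by rw [div_le_iff₀ hσ0]; linarith
    linarith
  have k3 : v ^ (σ + 1) * Real.log v ^ 2 < 4 := by
    have h2' : v ^ (σ + 1) ≤ v := by
      calc v ^ (σ + 1) ≤ v ^ (1 : ℝ) := Real.rpow_le_rpow_of_exponent_ge hv0 hv1 (by linarith)
        _ = v := Real.rpow_one v
    have := mul_log_sq_lt_four hv0 hv1
    nlinarith [sq_nonneg (Real.log v)]
  have hτ0 : 0 ≤ |τ| := abs_nonneg τ
  have hτ2 : |τ| * |τ| = τ ^ 2 := by rw [← sq, sq_abs]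
  have hmid : |τ| * (v ^ σ * (2 * |τ| * |Real.log v|)) = τ ^ 2 * (2 * (v ^ σ * |Real.log v|)) := by
    rw [← hτ2]; ring
  calc ‖(((σ : ℂ) + 1) * (a + b - 2 * c) + τ * I * (a - b)) * q + (a' + b' - 2 * c') * m‖
      ≤ ‖(((σ : ℂ) + 1) * (a + b - 2 * c) + τ * I * (a - b))‖ * ‖q‖ + ‖a' + b' - 2 * c'‖ * ‖m‖ := by
        rw [← norm_mul, ← norm_mul]; exact norm_add_le _ _
    _ ≤ (‖((σ : ℂ) + 1)‖ * ‖a + b - 2 * c‖ + ‖(τ : ℂ) * I‖ * ‖a - b‖) * ‖q‖ + ‖a' + b' - 2 * c'‖ * ‖m‖ := by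
        gcongr
        calc ‖((σ : ℂ) + 1) * (a + b - 2 * c) + τ * I * (a - b)‖
            ≤ ‖((σ : ℂ) + 1) * (a + b - 2 * c)‖ + ‖τ * I * (a - b)‖ := norm_add_le _ _
          _ = _ := by rw [norm_mul, norm_mul]
    _ ≤ ((σ + 1) * (v ^ σ * (τ * Real.log v) ^ 2) + |τ| * (v ^ σ * (2 * |τ| * |Real.log v|))) * 1 +
          (v ^ (σ + 1) * (τ * Real.log v) ^ 2) * 2 := by
        rw [hσn, norm_mul, Complex.norm_I, mul_one, Complex.norm_real, Real.norm_eq_abs]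
        gcongr
    _ = τ ^ 2 * ((σ + 1) * (v ^ σ * Real.log v ^ 2) + 2 * (v ^ σ * |Real.log v|) +
          2 * (v ^ (σ + 1) * Real.log v ^ 2)) := by
        rw [hmid]; ring
    _ ≤ τ ^ 2 * (2 * 16 + 2 * 2 + 2 * 4) := by
        apply mul_le_mul_of_nonneg_left _ (sq_nonneg τ)
        have hσ2 : σ + 1 ≤ 2 := by linarith
        have k1' : (σ + 1) * (v ^ σ * Real.log v ^ 2) ≤ 2 * 16 :=
          mul_le_mul hσ2 k1.le (by positivity) (by norm_num)
        linarith
    _ = 44 * τ ^ 2 := by ring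

/-- **The `1/λ` bound**: `‖Ŵ_λ(σ+iτ) + Ŵ_λ(σ−iτ) − 2Ŵ_λ(σ)‖ ≤ 44τ²/(2π|λ|)` for `1/2 ≤ σ ≤ 1`,
`λ ≠ 0` (the representation `twistMellin_eq_parts` at the three points and `norm_parts_symmDiff_le`).
[folklore] -/
theorem norm_twistMellin_symmDiff_le_div {σ : ℝ} (hσ : 1 / 2 ≤ σ) (hσ1 : σ ≤ 1) (τ : ℝ) {lam : ℝ}
    (hlam : lam ≠ 0) :
    ‖twistMellin lam (σ + τ * I) + twistMellin lam (σ - τ * I) - 2 * twistMellin lam σ‖ ≤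
      44 * τ ^ 2 / (2 * π * |lam|) := by
  have hσ0 : 0 < σ := by linarith
  have hs1 : 0 < ((σ : ℂ) + τ * I).re := by simp [hσ0]
  have hs2 : 0 < ((σ : ℂ) - τ * I).re := by simp [hσ0]
  have hs3 : 0 < ((σ : ℂ)).re := by simp [hσ0]
  rw [twistMellin_eq_parts hs1 hlam, twistMellin_eq_parts hs2 hlam, twistMellin_eq_parts hs3 hlam]
  have i1 := intervalIntegrable_parts_integrand hs1 lam
  have i2 := intervalIntegrable_parts_integrand hs2 lam
  have i3 := (intervalIntegrable_parts_integrand hs3 lam).const_mul (2 : ℂ)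
  set K : ℂ := -(1 / (2 * π * I * lam)) with hK
  have hKn : ‖K‖ = 1 / (2 * π * |lam|) := by
    rw [hK, norm_neg, norm_div, norm_one]
    congr 1
    rw [norm_mul, norm_mul, norm_mul, Complex.norm_I, mul_one, Complex.norm_real, Complex.norm_ofNat,
      Complex.norm_real, Real.norm_eq_abs, Real.norm_eq_abs, abs_of_pos Real.pi_pos]
  have halg : ∀ P Q R : ℂ, K * P + K * Q - 2 * (K * R) = K * (P + Q - 2 * R) := fun P Q R => by ring
  rw [halg, ← intervalIntegral.integral_const_mul, ← intervalIntegral.integral_add i1 i2,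
    ← intervalIntegral.integral_sub (i1.add i2) i3, norm_mul, hKn]
  have hint : ‖∫ v in (0 : ℝ)..1,
      ((((σ : ℂ) + τ * I) + 1) * (v : ℂ) ^ ((σ : ℂ) + τ * I) * ((((1 - v) ^ 2 : ℝ)) : ℂ) +
          (v : ℂ) ^ (((σ : ℂ) + τ * I) + 1) * (((-(2 * (1 - v)) : ℝ)) : ℂ)) * (𝐞 (lam * v) : ℂ) +
        ((((σ : ℂ) - τ * I) + 1) * (v : ℂ) ^ ((σ : ℂ) - τ * I) * ((((1 - v) ^ 2 : ℝ)) : ℂ) +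
          (v : ℂ) ^ (((σ : ℂ) - τ * I) + 1) * (((-(2 * (1 - v)) : ℝ)) : ℂ)) * (𝐞 (lam * v) : ℂ) -
        2 * (((((σ : ℂ)) + 1) * (v : ℂ) ^ (σ : ℂ) * ((((1 - v) ^ 2 : ℝ)) : ℂ) +
          (v : ℂ) ^ ((σ : ℂ) + 1) * (((-(2 * (1 - v)) : ℝ)) : ℂ)) * (𝐞 (lam * v) : ℂ))‖ ≤
      44 * τ ^ 2 * |(1 : ℝ) - 0| := by
    refine intervalIntegral.norm_integral_le_of_norm_le_const fun v hv => ?_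
    rw [uIoc_of_le zero_le_one, mem_Ioc] at hv
    obtain ⟨hv0, hv1⟩ := hv
    have hfac : ∀ P Q R E : ℂ, P * E + Q * E - 2 * (R * E) = (P + Q - 2 * R) * E := fun P Q R E => by ring
    rw [hfac, norm_mul, Circle.norm_coe, mul_one]
    exact norm_parts_symmDiff_le hσ hσ1 hv0 hv1 τ
  rw [show |(1 : ℝ) - 0| = 1 by norm_num, mul_one] at hint
  have hπ : 0 < 2 * π * |lam| := by have := Real.pi_pos; have := abs_pos.mpr hlam; positivity
  calc 1 / (2 * π * |lam|) * _ ≤ 1 / (2 * π * |lam|) * (44 * τ ^ 2) :=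
        mul_le_mul_of_nonneg_left hint (by positivity)
    _ = 44 * τ ^ 2 / (2 * π * |lam|) := by ring

/-- **The second symmetric difference, combined**:
`‖Ŵ_λ(σ+iτ) + Ŵ_λ(σ−iτ) − 2Ŵ_λ(σ)‖ ≤ 15τ²/(1+|λ|)` for `1/2 ≤ σ ≤ 1`. [folklore] -/
theorem norm_twistMellin_symmDiff_le {σ : ℝ} (hσ : 1 / 2 ≤ σ) (hσ1 : σ ≤ 1) (τ lam : ℝ) :
    ‖twistMellin lam (σ + τ * I) + twistMellin lam (σ - τ * I) - 2 * twistMellin lam σ‖ ≤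
      15 * τ ^ 2 / (1 + |lam|) := by
  have hτ0 : 0 ≤ τ ^ 2 := sq_nonneg τ
  rcases le_or_gt |lam| 1 with hsmall | hbig
  · have h := norm_twistMellin_symmDiff_le_sq (by linarith : (0 : ℝ) ≤ σ) τ lam
    refine h.trans ?_
    rw [le_div_iff₀ (by positivity)]
    nlinarith [abs_nonneg lam]
  · have hlam : lam ≠ 0 := by intro h; rw [h, abs_zero] at hbig; linarith
    have h := norm_twistMellin_symmDiff_le_div hσ hσ1 τ hlam
    refine h.trans ?_
    have hπ := Real.pi_gt_three
    rw [div_le_div_iff₀ (by positivity) (by positivity)]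
    have h1 : 44 * (1 + |lam|) ≤ 15 * (2 * π * |lam|) := by nlinarith
    nlinarith [mul_le_mul_of_nonneg_left h1 hτ0]

end TwistedWeight

end Literature.NumberTheory.Sieve

end
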